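/-
Origin: expansion seat `planner-pub-hodgecm-pohl-g15-0`, handover #10 2026-08-18T16:19:39Z (md5 d4b7cdd79a24be8cd76140e07056b265, 231 l.; RUN-32 CANDIDATE ROW, ON REQUEST ONLY — TREE-SHAPE SPLIT (≤400 l.) of the pohl lineage, source lines verbatim; NEW first part; lands AFTER — (imports PKG NonGaloisInduced + Model.SexticCM.SexticField); no import rewrite) (`HOME/pub-hodgecm-pohl-g15/lean/Pohl15/NonGaloisWitnessCubic.lean`, md5 d4b7cdd7, 231 lines);
landed by the packager successor (mc-unitary-1-g3, gen-8 kit) in gate run 32 as `HodgeCM/Proofs/Pohlmann/NonGaloisWitnessCubic.lean` (verbatim).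
-/
/-
Copyright: pub-hodgecm formalisation cell (harness21, 2026). New file (not vendored).
Origin: HOME/pub-hodgecm-pohl-g15/lean/Pohl15/NonGaloisWitnessCubic.lean — session planner-pub-hodgecm-pohl-g15-0 (unit pub-hodgecm-pohl-g15),
EXPANSION part (b) `PohlmannSpan`, generation 15: TREE-SHAPE STAGING under the 400-line rule of lean/CONVENTIONS.md §2 — part 1/2
of the split of `HodgeCM/Proofs/Pohlmann/NonGaloisWitness.lean` (pohl-g11, gate run 29; 463 l., md5 d77cf33d8b57): source lines 36–240 VERBATIM; the module docstring below is new (it only describes the cut).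
Intended final place: `HodgeCM/Proofs/Pohlmann/NonGaloisWitnessCubic.lean` (module `HodgeCM.Proofs.Pohlmann.NonGaloisWitnessCubic`); imports final (certified package modules only).
-/
import Summits.HodgeConjecture.HodgeCM.Proofs.Pohlmann.NonGaloisInduced
import Summits.HodgeConjecture.HodgeCM.Model.SexticCM.SexticField

/-!
# A concrete CM field with `Aut = {1, c}`, I: the non-normal cubic field `F = ℚ(β₀)` and the sextic field `K₂ = F(i)`

First half of the former `NonGaloisWitness.lean` (pohl-g11), split before its section "`K₂ / F` is a CM extension" under the
tree's 400-line rule (lean/CONVENTIONS.md §2); every declaration below is the source's, verbatim.  Contents: non-normality of the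
totally real cubic field `F = ℚ(β₀) = ℚ(α₀)` of toy2's `SexticCM` layer (`Model/SexticCM/SexticField.lean`); the sextic field
`K₂ = ℚ(β₀, i) ⊂ ℂ`, the subfield `ℚ(i)`, their embeddings and degrees.  That `K₂/F` is a CM extension, `Aut(K₂/ℚ) = {1, c}`, the
imaginary quadratic subfield `ℚ(i) ⊂ K₂` and the failure of the naive Pohlmann span for `K₂` are in `NonGaloisWitness.lean`, which
imports this file and keeps the module name.  Nothing is cited; everything is kernel-checked.
-/

noncomputable section

open Polynomial IntermediateField NumberField NumberField.ComplexEmbedding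

namespace HodgeCM

namespace SexticCM

/-! ### Non-normality of the cubic field `F = ℚ(β₀) = ℚ(α₀)` -/

/-- (Ported verbatim from the HodgeCMPerL package; no docstring in the source.) -/
theorem coe_α_eq (k : Fin 3) : ((α k : ℝ) : ℂ) = 2 - ((β k : ℝ) : ℂ) := by
  simp only [β, Complex.ofReal_sub, Complex.ofReal_ofNat]; ring

/-- (Ported verbatim from the HodgeCMPerL package; no docstring in the source.) -/
theorem β0_mem_F : ((β 0 : ℝ) : ℂ) ∈ F := mem_adjoin_simple_self ℚ _

/-- (Ported verbatim from the HodgeCMPerL package; no docstring in the source.) -/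
theorem α0_mem_F : ((α 0 : ℝ) : ℂ) ∈ F := by
  rw [coe_α_eq]
  exact sub_mem (ofNat_mem F 2) β0_mem_F

/-- `d = (α₀-α₁)(α₁-α₂)(α₂-α₀)`, a square root of the discriminant `229` of `x³ - 4x + 1`. -/
def discRoot : ℝ := (α 0 - α 1) * (α 1 - α 2) * (α 2 - α 0)

/-- (Ported verbatim from the HodgeCMPerL package; no docstring in the source.) -/
theorem discRoot_sq : discRoot ^ 2 = 229 := by
  obtain ⟨h1, h2, h3⟩ := vieta
  have key : ∀ a b c : ℝ, ((a - b) * (b - c) * (c - a)) ^ 2 =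
      (a + b + c) ^ 2 * (a * b + a * c + b * c) ^ 2 - 4 * (a * b + a * c + b * c) ^ 3
        - 4 * (a + b + c) ^ 3 * (a * b * c) + 18 * (a + b + c) * (a * b + a * c + b * c) * (a * b * c)
        - 27 * (a * b * c) ^ 2 := fun a b c => by ring
  rw [discRoot, key, h1, h2, h3]; norm_num

/-- (Ported verbatim from the HodgeCMPerL package; no docstring in the source.) -/
theorem discRootC_sq : ((discRoot : ℝ) : ℂ) ^ 2 = 229 := by exact_mod_cast discRoot_sq

/-- (Ported verbatim from the HodgeCMPerL package; no docstring in the source.) -/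
theorem discRootC_isIntegral : IsIntegral ℚ ((discRoot : ℝ) : ℂ) :=
  ⟨X ^ 2 - C 229, monic_X_pow_sub_C _ two_ne_zero, by simp [discRootC_sq]⟩

/-- `d ∉ ℚ` (`√229` is irrational). -/
theorem discRootC_not_mem_range : ((discRoot : ℝ) : ℂ) ∉ (algebraMap ℚ ℂ).range := by
  rintro ⟨q, hq⟩
  have hqR : (q : ℝ) = discRoot := by
    have h : ((q : ℝ) : ℂ) = ((discRoot : ℝ) : ℂ) := by rw [Complex.ofReal_ratCast, ← hq, eq_ratCast]
    exact Complex.ofReal_injective h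
  have habs : Real.sqrt 229 = ((|q| : ℚ) : ℝ) := by
    rw [Rat.cast_abs, hqR, ← Real.sqrt_sq_eq_abs, discRoot_sq]
  have hirr : Irrational (Real.sqrt 229) := by norm_num
  exact hirr.ne_rat |q| habs

/-- The three roots `α₀, α₁, α₂` do not all lie in the cubic field `F`: with them `d` (`d² = 229`) would lie in `F`, but
`[ℚ(d):ℚ] = 2 ∤ 3 = [F:ℚ]`. -/
theorem not_forall_α_mem_F : ¬ ∀ k, ((α k : ℝ) : ℂ) ∈ F := by
  intro h
  have hd : ((discRoot : ℝ) : ℂ) ∈ F := by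
    have e : ((discRoot : ℝ) : ℂ) =
        (((α 0 : ℝ) : ℂ) - (α 1 : ℝ)) * (((α 1 : ℝ) : ℂ) - (α 2 : ℝ)) * (((α 2 : ℝ) : ℂ) - (α 0 : ℝ)) := by
      simp only [discRoot, Complex.ofReal_mul, Complex.ofReal_sub]
    rw [e]
    exact mul_mem (mul_mem (sub_mem (h 0) (h 1)) (sub_mem (h 1) (h 2))) (sub_mem (h 2) (h 0))
  have hle : ℚ⟮((discRoot : ℝ) : ℂ)⟯ ≤ F := adjoin_simple_le_iff.mpr hd
  obtain ⟨c, hc⟩ := finrank_dvd_of_le_right hle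
  rw [finrank_F, adjoin.finrank discRootC_isIntegral] at hc
  have h2 : 2 ≤ (minpoly ℚ ((discRoot : ℝ) : ℂ)).natDegree :=
    (minpoly.two_le_natDegree_iff discRootC_isIntegral).mpr discRootC_not_mem_range
  have h2' : (minpoly ℚ ((discRoot : ℝ) : ℂ)).natDegree ≤ 2 := by
    have hdvd : minpoly ℚ ((discRoot : ℝ) : ℂ) ∣ X ^ 2 - C 229 := minpoly.dvd ℚ _ (by simp [discRootC_sq])
    simpa only [natDegree_X_pow_sub_C] using natDegree_le_of_dvd hdvd (X_pow_sub_C_ne_zero two_pos _)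
  have hn : (minpoly ℚ ((discRoot : ℝ) : ℂ)).natDegree = 2 := le_antisymm h2' h2
  rw [hn] at hc
  omega

/-- (Ported verbatim from the HodgeCMPerL package; no docstring in the source.) -/
private theorem mem_of_sum_eq_zero {a b c : ℂ} (h : a + b + c = 0) (ha : a ∈ F) (hb : b ∈ F) : c ∈ F := by
  have e : c = -(a + b) := by linear_combination h
  rw [e]
  exact neg_mem (add_mem ha hb)

/-- **`F = ℚ(α₀)` is not normal**: for `j ≠ 0` the root `α_j` of `x³ - 4x + 1` is not in `F`. -/
theorem α_not_mem_F : ∀ {j : Fin 3}, j ≠ 0 → ((α j : ℝ) : ℂ) ∉ F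
  | 0, h => absurd rfl h
  | 1, _ => fun h1 => not_forall_α_mem_F fun k => by
      fin_cases k
      · exact α0_mem_F
      · exact h1
      · exact mem_of_sum_eq_zero vietaC.1 α0_mem_F h1
  | 2, _ => fun h2 => not_forall_α_mem_F fun k => by
      fin_cases k
      · exact α0_mem_F
      · have hs := vietaC.1
        rw [add_right_comm] at hs
        exact mem_of_sum_eq_zero hs α0_mem_F h2
      · exact h2

/-- (Ported verbatim from the HodgeCMPerL package; no docstring in the source.) -/
theorem β_not_mem_F {j : Fin 3} (hj : j ≠ 0) : ((β j : ℝ) : ℂ) ∉ F := fun h =>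
  α_not_mem_F hj (by rw [coe_α_eq]; exact sub_mem (ofNat_mem F 2) h)

/-! ### The sextic CM field `K₂ = ℚ(β₀, i) = F(i)` -/

/-- `K₂ = ℚ(β₀, i) ⊂ ℂ`: the compositum of the non-normal totally real cubic field `F = ℚ(β₀)` with `ℚ(i)`. -/
def K₂ : IntermediateField ℚ ℂ := ℚ⟮((β 0 : ℝ) : ℂ), Complex.I⟯

/-- `ℚ(i) ⊂ ℂ` -/
def Qi : IntermediateField ℚ ℂ := ℚ⟮Complex.I⟯

/-- (Ported verbatim from the HodgeCMPerL package; no docstring in the source.) -/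
theorem isIntegral_I : IsIntegral ℚ Complex.I := ⟨X ^ 2 + 1, by monicity!, by simp⟩

/-- (Ported verbatim from the HodgeCMPerL package; no docstring in the source.) -/
theorem neg_I_ne_I : -Complex.I ≠ Complex.I := fun h => Complex.I_ne_zero (by linear_combination (-1 / 2 : ℂ) * h)

/-- (Ported verbatim from the HodgeCMPerL package; no docstring in the source.) -/
theorem eq_I_or_eq_neg_I_of_sq {z : ℂ} (h : z ^ 2 = -1) : z = Complex.I ∨ z = -Complex.I := by
  have h' : (z - Complex.I) * (z + Complex.I) = 0 := by linear_combination h - Complex.I_sq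
  rcases mul_eq_zero.mp h' with h1 | h1
  · exact .inl (sub_eq_zero.mp h1)
  · exact .inr (eq_neg_of_add_eq_zero_left h1)

/-- (Ported verbatim from the HodgeCMPerL package; no docstring in the source.) -/
theorem β0_mem_K₂ : ((β 0 : ℝ) : ℂ) ∈ K₂ := subset_adjoin ℚ _ (Set.mem_insert _ _)

/-- (Ported verbatim from the HodgeCMPerL package; no docstring in the source.) -/
theorem I_mem_K₂ : Complex.I ∈ K₂ := subset_adjoin ℚ _ (Set.mem_insert_of_mem _ rfl)

/-- (Ported verbatim from the HodgeCMPerL package; no docstring in the source.) -/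
theorem I_mem_Qi : Complex.I ∈ Qi := mem_adjoin_simple_self ℚ _

/-- (Ported verbatim from the HodgeCMPerL package; no docstring in the source.) -/
theorem F_le_K₂ : F ≤ K₂ := adjoin_simple_le_iff.mpr β0_mem_K₂

/-- (Ported verbatim from the HodgeCMPerL package; no docstring in the source.) -/
theorem Qi_le_K₂ : Qi ≤ K₂ := adjoin_simple_le_iff.mpr I_mem_K₂

/-- (Ported verbatim from the HodgeCMPerL package; no docstring in the source.) -/
theorem K₂_eq_sup : K₂ = F ⊔ Qi :=
  le_antisymm
    (adjoin_le_iff.mpr (Set.insert_subset_iff.mpr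
      ⟨(le_sup_left : F ≤ F ⊔ Qi) β0_mem_F, Set.singleton_subset_iff.mpr ((le_sup_right : Qi ≤ F ⊔ Qi) I_mem_Qi)⟩))
    (sup_le F_le_K₂ Qi_le_K₂)

/-- `F ⊂ ℝ`, so `i ∉ F`. -/
theorem I_not_mem_F : Complex.I ∉ F := fun h => by
  have hc := conj_eq_of_mem_Qb h
  rw [Complex.conj_I] at hc
  exact neg_I_ne_I hc

/-- (Ported verbatim from the HodgeCMPerL package; no docstring in the source.) -/
instance finiteDimensional_Qi : FiniteDimensional ℚ Qi := adjoin.finiteDimensional isIntegral_I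

/-- (Ported verbatim from the HodgeCMPerL package; no docstring in the source.) -/
instance finiteDimensional_K₂ : FiniteDimensional ℚ K₂ :=
  finiteDimensional_adjoin fun x hx => by
    rcases Set.mem_insert_iff.mp hx with rfl | hx
    · exact isIntegral_b
    · rw [Set.mem_singleton_iff.mp hx]; exact isIntegral_I

/-- (Ported verbatim from the HodgeCMPerL package; no docstring in the source.) -/
theorem finrank_Qi_le : Module.finrank ℚ Qi ≤ 2 := by
  rw [Qi, adjoin.finrank isIntegral_I]
  have hdvd : minpoly ℚ Complex.I ∣ X ^ 2 + 1 := minpoly.dvd ℚ _ (by simp)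
  have hmon : (X ^ 2 + 1 : ℚ[X]).Monic := by monicity!
  have hdeg : (X ^ 2 + 1 : ℚ[X]).natDegree = 2 := by compute_degree!
  simpa only [hdeg] using natDegree_le_of_dvd hdvd hmon.ne_zero

/-- (Ported verbatim from the HodgeCMPerL package; no docstring in the source.) -/
theorem finrank_K₂_le : Module.finrank ℚ K₂ ≤ 6 := by
  rw [K₂_eq_sup]
  calc Module.finrank ℚ ↥(F ⊔ Qi) ≤ Module.finrank ℚ F * Module.finrank ℚ Qi := finrank_sup_le F Qi
    _ ≤ 3 * 2 := Nat.mul_le_mul finrank_F.le finrank_Qi_le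

/-- `[K₂:ℚ] = 6` -/
theorem finrank_K₂ : Module.finrank ℚ K₂ = 6 := by
  obtain ⟨c, hc⟩ := finrank_dvd_of_le_right F_le_K₂
  rw [finrank_F] at hc
  have h6 := finrank_K₂_le
  have hpos : 0 < Module.finrank ℚ K₂ := Module.finrank_pos
  have hc' : c = 1 ∨ c = 2 := by omega
  rcases hc' with rfl | rfl
  · exfalso
    have hFK : F = K₂ := eq_of_le_of_finrank_eq F_le_K₂ (by rw [finrank_F, hc])
    exact I_not_mem_F (hFK ▸ I_mem_K₂)
  · omega

/-- (Ported verbatim from the HodgeCMPerL package; no docstring in the source.) -/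
instance instNumberFieldK₂ : NumberField K₂ := NumberField.of_module_finite ℚ K₂

/-- `β₀ ∈ K₂` as an element -/
def bK₂ : K₂ := ⟨((β 0 : ℝ) : ℂ), β0_mem_K₂⟩

/-- `i ∈ K₂` as an element -/
def iK₂ : K₂ := ⟨Complex.I, I_mem_K₂⟩

/-- (Ported verbatim from the HodgeCMPerL package; no docstring in the source.) -/
@[simp] theorem coe_bK₂ : ((bK₂ : K₂) : ℂ) = ((β 0 : ℝ) : ℂ) := rfl

/-- (Ported verbatim from the HodgeCMPerL package; no docstring in the source.) -/
@[simp] theorem coe_iK₂ : ((iK₂ : K₂) : ℂ) = Complex.I := rfl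

/-- (Ported verbatim from the HodgeCMPerL package; no docstring in the source.) -/
theorem inclusion_bF : IntermediateField.inclusion F_le_K₂ bF = bK₂ := rfl

/-- (Ported verbatim from the HodgeCMPerL package; no docstring in the source.) -/
theorem iK₂_sq : (iK₂ : K₂) ^ 2 = -1 := by
  apply (algebraMap K₂ ℂ).injective
  simp only [map_pow, map_neg, map_one, IntermediateField.algebraMap_apply, coe_iK₂, Complex.I_sq]

/-- Every embedding `K₂ →+* ℂ` sends `β₀` to some `β_k` … -/
theorem emb_bK₂ (φ : K₂ →+* ℂ) : ∃ k, φ bK₂ = ((β k : ℝ) : ℂ) :=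
  emb_bF (φ.comp (IntermediateField.inclusion F_le_K₂).toRingHom)

/-- … and `i` to `±i`. -/
theorem emb_iK₂ (φ : K₂ →+* ℂ) : φ iK₂ = Complex.I ∨ φ iK₂ = -Complex.I := by
  have h := congrArg φ iK₂_sq
  rw [map_pow, map_neg, map_one] at h
  exact eq_I_or_eq_neg_I_of_sq h

/-- (Ported verbatim from the HodgeCMPerL package; no docstring in the source.) -/
theorem emb_iK₂_not_real (φ : K₂ →+* ℂ) : (starRingEnd ℂ) (φ iK₂) ≠ φ iK₂ := by
  rcases emb_iK₂ φ with h | h <;> rw [h]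
  · rw [Complex.conj_I]; exact neg_I_ne_I
  · rw [map_neg, Complex.conj_I, neg_neg]; exact fun e => neg_I_ne_I e.symm

/-- (Ported verbatim from the HodgeCMPerL package; no docstring in the source.) -/
instance instIsTotallyComplexK₂ : IsTotallyComplex K₂ where
  isComplex w := by
    rw [← InfinitePlace.not_isReal_iff_isComplex, ← InfinitePlace.mk_embedding w,
      InfinitePlace.isReal_mk_iff, ComplexEmbedding.isReal_iff]
    intro h
    exact emb_iK₂_not_real w.embedding (by rw [← ComplexEmbedding.conjugate_coe_eq, h])

end SexticCM

end HodgeCM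

end
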